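import Literature.NumberTheory.Automorphic.AutomorphicFormsTranslates
import Literature.NumberTheory.Automorphic.AdelicHeightGLProofs
import Literature.NumberTheory.Automorphic.AutomorphicRepsGLCuspidalL2
import HarnessLib

/-!
# Finite-adelic right translates of automorphic forms on `GL_n(𝔸_K)`; `GL_n(𝔸_K^∞)`-stability
of the spaces `V_Π`

Topic `NumberTheory/Automorphic`. The `GL_n` specialisation of `AutomorphicFormsTranslates`
(Borel–Jacquet 1979, 4.3: `𝒜` is a `G(𝔸_f)`-module under right translation) for the honest datum
`AutomorphyDatum.gl n K hcpt`:

* `finiteLevelsGL_conj` — the family of levels `{1} × U₀` (`U₀ ≤ GL_n(𝔸_K^∞)` compact open) is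
  stable under conjugation by `GL_n(𝔸_K^∞)`: `{1} × h₀ U₀ h₀⁻¹` is again a level.
* `IsAutomorphicForm.rightTranslation_gl` — for `y = (1, h₀) ∈ GL_n(𝔸_K^∞)` and an automorphic
  form `φ` on `GL_n(𝔸_K)`, `r(y) φ` is an automorphic form (`rightTranslation_of_commute` with the
  height bound `one_sup_adelicHeightGL_mul_le` of `AdelicHeightGLProofs`).
* `formsOfL2_finite_stable` — for a closed invariant subspace `Π ≤ L²(GL_n(𝔸_K) ⧸ A_G GL_n(K), μ)`
  the space `V_Π = formsOfL2 hcpt μ Π` (span of the automorphic forms `g ↦ f [g⁻¹]`, `[f] ∈ Π`) is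
  stable under right translation by `GL_n(𝔸_K^∞)` — the `finite_stable` field of
  `AutomorphicRepsGL.formsOfL2_isStableSubmodule` (Step 2 of Borel–Jacquet 4.6 for `GL_n`,
  `AutomorphicRepsGLCuspidalL2`), unconditionally.

Everything here is proved.

## References

* A. Borel, H. Jacquet, *Automorphic forms and automorphic representations*, Proc. Sympos. Pure
  Math. 33 (1979), part 1, §4.2, 4.3 and 4.6 [BorelJacquet1979].
-/

noncomputable section

open scoped MatrixGroups Classical
open NumberField NumberField.mixedEmbedding IsDedekindDomain
open _root_.MeasureTheory

namespace Literature.NumberTheory.Automorphic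

variable {n : ℕ} {K : Type} [Field K] [NumberField K]

/-! ### Levels are stable under finite-adelic conjugation -/

/-- **Conjugates of levels are levels.** For a level `U = {1} × U₀` of `GL_n` (`U₀ ≤ GL_n(𝔸_K^∞)`
compact open) and `h₀ ∈ GL_n(𝔸_K^∞)`, the subgroup `{1} × h₀ U₀ h₀⁻¹` is a level, and
`(1, h₀)⁻¹ u (1, h₀) ∈ U` for each of its elements `u`. Borel–Jacquet 1979, §4.1–4.3. [cite: BorelJacquet1979, §4.3] -/
theorem finiteLevelsGL_conj {U : Subgroup (GL (Fin n) (AdeleRing (𝓞 K) K))}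
    (hU : U ∈ finiteLevelsGL n K) (h₀ : GL (Fin n) (FiniteAdeleRing (𝓞 K) K)) :
    ∃ U' ∈ finiteLevelsGL n K, ∀ u ∈ U',
      (GLn.ofFinite n K h₀)⁻¹ * u * GLn.ofFinite n K h₀ ∈ U := by
  obtain ⟨U₀, hU₀o, hU₀c, rfl⟩ := hU
  refine ⟨(U₀.map (MulAut.conj h₀).toMonoidHom).map (GLn.ofFinite n K), ⟨_, ?_, ?_, rfl⟩, ?_⟩
  · -- openness: the conjugate is the preimage of `U₀` under `x ↦ h₀⁻¹ x h₀`
    rw [Subgroup.map_equiv_eq_comap_symm']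
    change IsOpen ((fun x => (MulAut.conj h₀).symm.toMonoidHom x) ⁻¹' (U₀ : Set _))
    refine hU₀o.preimage ?_
    change Continuous fun x => (MulAut.conj h₀).symm x
    simp only [MulAut.conj_symm_apply]
    exact (continuous_const.mul continuous_id).mul continuous_const
  · -- compactness: the conjugate is the image of `U₀` under `x ↦ h₀ x h₀⁻¹`
    rw [Subgroup.coe_map]
    refine hU₀c.image ?_
    change Continuous fun x => MulAut.conj h₀ x
    simp only [MulAut.conj_apply]
    exact (continuous_const.mul continuous_id).mul continuous_const
  · rintro _ ⟨_, ⟨u₀, hu₀, rfl⟩, rfl⟩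
    refine ⟨u₀, hu₀, ?_⟩
    change GLn.ofFinite n K u₀ = (GLn.ofFinite n K h₀)⁻¹ *
      GLn.ofFinite n K (MulAut.conj h₀ u₀) * GLn.ofFinite n K h₀
    rw [MulAut.conj_apply, map_mul, map_mul, map_inv]
    group

/-! ### Finite-adelic translates of automorphic forms on `GL_n` -/

section GLn

variable {hcpt : isCompact_glFiniteIntegralLevel n K}

/-- **Finite-adelic right translates of automorphic forms on `GL_n(𝔸_K)` are automorphic forms**
(Borel–Jacquet 1979, 4.3): for `y ∈ GL_n(𝔸_K^∞) = {1} × GL_n(𝔸_K^∞)` and `φ` automorphic for the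
datum `AutomorphyDatum.gl n K hcpt`, `r(y) φ = (g ↦ φ (g y))` is automorphic: `y` centralises
`GL_n(K_∞)`, levels are conjugation-stable (`finiteLevelsGL_conj`) and
`1 ⊔ ‖g y‖ ≤ (1 ⊔ n ‖y‖) (1 ⊔ ‖g‖)` (`one_sup_adelicHeightGL_mul_le`). [cite: BorelJacquet1979, 4.3] -/
theorem IsAutomorphicForm.rightTranslation_gl {φ : (AdelicGroupData.gl n K).Adelic → ℂ}
    (hφ : IsAutomorphicForm (AutomorphyDatum.gl n K hcpt) φ) {y : (AdelicGroupData.gl n K).Adelic}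
    (hy : y ∈ (AutomorphyDatum.gl n K hcpt).finiteAdelic) :
    IsAutomorphicForm (AutomorphyDatum.gl n K hcpt) (rightTranslation (AdelicGroupData.gl n K) y φ) := by
  have hy' : ∃ h₀, GLn.ofFinite n K h₀ = y := hy
  obtain ⟨h₀, rfl⟩ := hy'
  refine hφ.rightTranslation_of_commute (fun h => (AutomorphyDatum.gl n K hcpt).commute_ofArch h _ hy)
    (fun U hU => finiteLevelsGL_conj hU h₀) (C := 1 ⊔ n * adelicHeightGL n K (GLn.ofFinite n K h₀))
    fun g => ?_
  exact one_sup_adelicHeightGL_mul_le g (GLn.ofFinite n K h₀)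

end GLn

/-! ### `GL_n(𝔸_K^∞)`-stability of `V_Π` -/

section L2

variable {hcpt : isCompact_glFiniteIntegralLevel n K}
  {μ : Measure (AdelicGroupData.gl n K).automorphicQuotient}
  [SMulInvariantMeasure (AdelicGroupData.gl n K).Adelic
    (AdelicGroupData.gl n K).automorphicQuotient μ]

/-- **`V_Π` is stable under right translation by `GL_n(𝔸_K^∞)`** (the `finite_stable` part of
Step 2 of Borel–Jacquet 4.6 for `GL_n`): for a closed invariant subspace `Π ≤ L²` and
`y ∈ GL_n(𝔸_K^∞)`, `r(y)` maps `V_Π = formsOfL2 hcpt μ Π` into itself — on generators,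
`r(y) (g ↦ f [g⁻¹]) = (g ↦ f' [g⁻¹])` with `f' = f (y⁻¹ • ·)`, whose class is `Π(y) [f] ∈ Π`, and
`r(y) (g ↦ f [g⁻¹])` is automorphic (`IsAutomorphicForm.rightTranslation_gl`).
Borel–Jacquet 1979, 4.3 and 4.6. [cite: BorelJacquet1979, 4.6] -/
theorem formsOfL2_finite_stable
    (P : ContRepresentation.ClosedSubrep ((AdelicGroupData.gl n K).rightRegular μ))
    {y : (AdelicGroupData.gl n K).Adelic} (hy : y ∈ (AutomorphyDatum.gl n K hcpt).finiteAdelic) :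
    formsOfL2 hcpt μ P ≤ (formsOfL2 hcpt μ P).comap (rightTranslation (AdelicGroupData.gl n K) y) := by
  refine Submodule.span_le.2 ?_
  rintro φ ⟨f, hf, hfP, rfl, hφ⟩
  rw [SetLike.mem_coe, Submodule.mem_comap, ← invQuot_smul]
  have hf' : MemLp (fun x => f (y⁻¹ • x)) 2 μ :=
    hf.comp_measurePreserving (measurePreserving_smul y⁻¹ μ)
  refine invQuot_mem_formsOfL2 hf' ?_ ?_
  · have key : (AdelicGroupData.gl n K).rightRegular μ y (hf.toLp f) = hf'.toLp _ := by
      rw [AdelicGroupData.rightRegular_apply, DomMulAct.mk_smul_toLp]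
    rw [← key]
    exact P.apply_mem y hfP
  · rw [invQuot_smul]
    exact hφ.rightTranslation_gl hy

end L2

end Literature.NumberTheory.Automorphic
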